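import Mathlib
import Summits.ValiantsHypothesis.ValiantsHypothesis.Theorems.GeneratorObstructionsPowGenDegreeQPGadgetTableauFiberSum

/-!
# Route GeneratorObstructions — crux K2 `PowGenDegreeQP` (stmt-ValiantsHypothesis-11655), line
# `trace-side-regimes`: the block fibres of the columns of the gadget tableau

Step (R2, first part) of the last certificate theorem (`gadgetTab_fiberSum_eq_pow`, skeleton on the
item).  After (R1) (`gadgetTab_count_eq_fiberSum`) the count is a sum over tuples of permutations of
the fibres `{r : Fin (h n) // rowBlock n r = j}`.  Here these fibres are identified:

* `letterRow_lt_colHeight_of_lt` — in a column `n < 3k·2^j` (full or of type `< j`) all three block-`j`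
  rows are present; `letterRow_lt_colHeight_pair` / `not_rowB_lt_colHeight_pair` — in a type-`j`
  column (`3k·2^j ≤ n < 3k·2^{j+1}`) exactly the `A'`/`A` rows are; `not_letterRow_lt_colHeight_of_le`
  — beyond, none;
* `fibreEquivTriple : fibre ≃ Fin 3` and `fibreEquivPair : fibre ≃ Fin 2` by the KIND of the row
  (`0 = A'`, `1 = A`, `2 = B`, the conventions of `dstarTripleLab` / `dstarPairLab` / `blockExpo`),
  with `(fibreEquivTriple …).symm κ = letterRow c j κ` on values; `fibre_isEmpty` beyond;
* signs are preserved by the transport (`Equiv.Perm.sign_permCongr`, recorded as `sign_transport`).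

Honest framing: combinatorics of one explicit tableau; no stub, crux or summit is settled here;
`VP ≠ VNP` untouched. [folklore]
-/

namespace Summit.ValiantsHypothesis.ValiantsHypothesis.Theorems.GeneratorObstructions.PowGenDegreeQP

open Literature.Computability.AlgebraicComplexity Literature.Computability.AlgebraicComplexity.TableauEval

-- `Summit.ValiantsHypothesis.ValiantsHypothesis.…` is the tree's mandated single-conjunct layout.
set_option linter.dupNamespace false

noncomputable section

/-! ## §1 Which block rows lie in which columns -/

/-- In a column `n < 3k·2^j` all three block-`j` rows are present (`j < c`, `k ≥ 1`). [folklore] -/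
theorem letterRow_lt_colHeight_of_lt {k c j n : ℕ} (hk : 1 ≤ k) (hj : j < c) (hn : n < 3 * k * 2 ^ j)
    (κ : Fin 3) : letterRow c j κ < colHeight k c n := by
  rw [lt_colHeight_iff]
  have hP := letterPos_le hj κ
  have hP' := le_letterPos c j κ
  by_cases h3 : n < 3 * k
  · left; exact ⟨h3, by unfold letterRow; omega⟩
  · right
    refine ⟨h3, ?_⟩
    have hq : n / (3 * k) < 2 ^ j := by rw [Nat.div_lt_iff_lt_mul (by omega)]; linarith
    have hq0 : n / (3 * k) ≠ 0 := by
      intro h0; rw [Nat.div_eq_zero_iff] at h0; omega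
    have hlog : Nat.log 2 (n / (3 * k)) < j := (Nat.log_lt_iff_lt_pow (by norm_num) hq0).mpr hq
    unfold letterRow
    omega

/-- In a type-`j` column (`3k·2^j ≤ n < 3k·2^{j+1}`) the `A'`/`A` rows of block `j` are present.
[folklore] -/
theorem letterRow_lt_colHeight_pair {k c j n : ℕ} (hk : 1 ≤ k) (hj : j < c) (hn1 : 3 * k * 2 ^ j ≤ n)
    (hn2 : n < 3 * k * 2 ^ (j + 1)) {κ : Fin 3} (hκ : κ ≠ 2) : letterRow c j κ < colHeight k c n := by
  rw [lt_colHeight_iff]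
  right
  have h1 : 1 ≤ 2 ^ j := Nat.one_le_two_pow
  have h3 : ¬ n < 3 * k := by nlinarith
  refine ⟨h3, ?_⟩
  have e1 : 2 ^ j ≤ n / (3 * k) := (Nat.le_div_iff_mul_le (by omega)).mpr (by linarith)
  have e2 : n / (3 * k) < 2 ^ (j + 1) := by rw [Nat.div_lt_iff_lt_mul (by omega)]; linarith
  have hlog : Nat.log 2 (n / (3 * k)) = j := Nat.log_eq_of_pow_le_of_lt_pow e1 e2
  have hP := letterPos_ge_of_ne_two hj hκ
  have hP2 := letterPos_le hj κ
  unfold letterRow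
  omega

/-- In a type-`j` column the `B` row of block `j` is absent. [folklore] -/
theorem not_rowB_lt_colHeight_pair {k c j n : ℕ} (hk : 1 ≤ k) (hj : j < c) (hn1 : 3 * k * 2 ^ j ≤ n)
    (hn : n < 3 * k * 2 ^ c) : ¬ letterRow c j 2 < colHeight k c n := by
  rw [rowB_lt_colHeight_iff hk hj hn]
  omega

/-- Beyond the type-`j` columns no block-`j` row is present. [folklore] -/
theorem not_letterRow_lt_colHeight_of_le {k c j n : ℕ} (hk : 1 ≤ k) (hj : j < c)
    (hn1 : 3 * k * 2 ^ (j + 1) ≤ n) (κ : Fin 3) : ¬ letterRow c j κ < colHeight k c n := by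
  rw [lt_colHeight_iff]
  have h1 : 1 ≤ 2 ^ j := Nat.one_le_two_pow
  rintro (⟨h3, -⟩ | ⟨h3, h⟩)
  · rw [pow_succ] at hn1; nlinarith
  · have e1 : 2 ^ (j + 1) ≤ n / (3 * k) := (Nat.le_div_iff_mul_le (by omega)).mpr (by linarith)
    have hlog : j + 1 ≤ Nat.log 2 (n / (3 * k)) := by
      have := Nat.log_mono_right (b := 2) e1
      rwa [Nat.log_pow (by norm_num)] at this
    have hP2 : letterPos c j κ ≤ 3 * j + 3 := by unfold letterPos; split_ifs <;> omega
    unfold letterRow at h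
    omega

/-! ## §2 The fibres -/

variable {σ : Type*}

/-- A member of the block-`j` fibre of column `n` is one of the three block-`j` rows, of kind
`kindOfRow`. [folklore] -/
theorem fibre_val_eq (k c : ℕ) (hk : 1 ≤ k) (hc : 1 ≤ c) (x : ℕ → σ)
    {n : Fin (gadgetTab k c hk hc x).C} {j : Fin c}
    (r : {r : Fin ((gadgetTab k c hk hc x).h n) // rowBlock k c hk hc x n r = j}) :
    (r.1 : ℕ) = letterRow c j (kindOfRow c r.1) := by
  have hr : (r.1 : ℕ) < 3 * c := lt_of_lt_of_le r.1.isLt (colHeight_le k c n)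
  have h := (letterRow_blockOfRow_kindOfRow hc hr).2
  have hj : blockOfRow c r.1 = j := congrArg Fin.val r.2
  rw [hj] at h
  exact h.symm

/-- **Triple fibres**: for `n < 3k·2^j` the block-`j` fibre of column `n` is `Fin 3`, by kind.
[folklore] -/
def fibreEquivTriple (k c : ℕ) (hk : 1 ≤ k) (hc : 1 ≤ c) (x : ℕ → σ)
    (n : Fin (gadgetTab k c hk hc x).C) (j : Fin c) (hn : n.val < 3 * k * 2 ^ j.val) :
    {r : Fin ((gadgetTab k c hk hc x).h n) // rowBlock k c hk hc x n r = j} ≃ Fin 3 where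
  toFun r := kindOfRow c r.1
  invFun κ := ⟨⟨letterRow c j κ, letterRow_lt_colHeight_of_lt hk j.isLt hn κ⟩,
    Fin.ext (blockOfRow_letterRow j.isLt κ)⟩
  left_inv r := by
    apply Subtype.ext; apply Fin.ext
    exact (fibre_val_eq k c hk hc x r).symm
  right_inv κ := kindOfRow_letterRow j.isLt κ

/-- Values of the inverse of `fibreEquivTriple`. [folklore] -/
@[simp] theorem fibreEquivTriple_symm_apply_val (k c : ℕ) (hk : 1 ≤ k) (hc : 1 ≤ c) (x : ℕ → σ)
    (n : Fin (gadgetTab k c hk hc x).C) (j : Fin c) (hn : n.val < 3 * k * 2 ^ j.val) (κ : Fin 3) :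
    (((fibreEquivTriple k c hk hc x n j hn).symm κ).1 : ℕ) = letterRow c j κ := rfl

/-- Values of `fibreEquivTriple`. [folklore] -/
theorem fibreEquivTriple_apply (k c : ℕ) (hk : 1 ≤ k) (hc : 1 ≤ c) (x : ℕ → σ)
    (n : Fin (gadgetTab k c hk hc x).C) (j : Fin c) (hn : n.val < 3 * k * 2 ^ j.val)
    (r : {r : Fin ((gadgetTab k c hk hc x).h n) // rowBlock k c hk hc x n r = j}) :
    fibreEquivTriple k c hk hc x n j hn r = kindOfRow c r.1 := rfl

/-- In a type-`j` column a fibre element has kind `A'` or `A`. [folklore] -/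
theorem kindOfRow_fibre_lt_two (k c : ℕ) (hk : 1 ≤ k) (hc : 1 ≤ c) (x : ℕ → σ)
    {n : Fin (gadgetTab k c hk hc x).C} {j : Fin c} (hn1 : 3 * k * 2 ^ j.val ≤ n.val)
    (r : {r : Fin ((gadgetTab k c hk hc x).h n) // rowBlock k c hk hc x n r = j}) :
    (kindOfRow c r.1 : ℕ) < 2 := by
  by_contra h
  have h2 : kindOfRow c r.1 = 2 := Fin.ext (by have := (kindOfRow c r.1).isLt; omega)
  have hv := fibre_val_eq k c hk hc x r
  rw [h2] at hv
  have hlt : letterRow c j 2 < colHeight k c n := by rw [← hv]; exact r.1.isLt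
  exact not_rowB_lt_colHeight_pair hk j.isLt hn1 n.isLt hlt

/-- **Pair fibres**: for `3k·2^j ≤ n < 3k·2^{j+1}` the block-`j` fibre of column `n` is `Fin 2`, by
kind. [folklore] -/
def fibreEquivPair (k c : ℕ) (hk : 1 ≤ k) (hc : 1 ≤ c) (x : ℕ → σ)
    (n : Fin (gadgetTab k c hk hc x).C) (j : Fin c) (hn1 : 3 * k * 2 ^ j.val ≤ n.val)
    (hn2 : n.val < 3 * k * 2 ^ (j.val + 1)) :
    {r : Fin ((gadgetTab k c hk hc x).h n) // rowBlock k c hk hc x n r = j} ≃ Fin 2 where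
  toFun r := ⟨kindOfRow c r.1, kindOfRow_fibre_lt_two k c hk hc x hn1 r⟩
  invFun κ := ⟨⟨letterRow c j (Fin.castSucc κ), letterRow_lt_colHeight_pair hk j.isLt hn1 hn2
      (by intro h; have := congrArg Fin.val h; simp at this; omega)⟩,
    Fin.ext (blockOfRow_letterRow j.isLt _)⟩
  left_inv r := by
    apply Subtype.ext; apply Fin.ext
    change letterRow c j (Fin.castSucc ⟨kindOfRow c r.1, _⟩) = _
    have : Fin.castSucc (⟨kindOfRow c r.1, kindOfRow_fibre_lt_two k c hk hc x hn1 r⟩ : Fin 2) =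
        kindOfRow c r.1 := Fin.ext rfl
    rw [this]
    exact (fibre_val_eq k c hk hc x r).symm
  right_inv κ := by
    apply Fin.ext
    change (kindOfRow c (letterRow c j (Fin.castSucc κ)) : ℕ) = κ
    rw [kindOfRow_letterRow j.isLt]
    rfl

/-- Values of the inverse of `fibreEquivPair`. [folklore] -/
@[simp] theorem fibreEquivPair_symm_apply_val (k c : ℕ) (hk : 1 ≤ k) (hc : 1 ≤ c) (x : ℕ → σ)
    (n : Fin (gadgetTab k c hk hc x).C) (j : Fin c) (hn1 : 3 * k * 2 ^ j.val ≤ n.val)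
    (hn2 : n.val < 3 * k * 2 ^ (j.val + 1)) (κ : Fin 2) :
    (((fibreEquivPair k c hk hc x n j hn1 hn2).symm κ).1 : ℕ) = letterRow c j (Fin.castSucc κ) := rfl

/-- **Empty fibres** beyond the type-`j` columns. [folklore] -/
theorem fibre_isEmpty (k c : ℕ) (hk : 1 ≤ k) (hc : 1 ≤ c) (x : ℕ → σ)
    (n : Fin (gadgetTab k c hk hc x).C) (j : Fin c) (hn : 3 * k * 2 ^ (j.val + 1) ≤ n.val) :
    IsEmpty {r : Fin ((gadgetTab k c hk hc x).h n) // rowBlock k c hk hc x n r = j} := by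
  refine ⟨fun r => ?_⟩
  have hv := fibre_val_eq k c hk hc x r
  have hlt : letterRow c j (kindOfRow c r.1) < colHeight k c n := by rw [← hv]; exact r.1.isLt
  exact not_letterRow_lt_colHeight_of_le hk j.isLt hn _ hlt

/-- Transporting a permutation along an equivalence preserves its sign (Mathlib, recorded in the
form used by the regrouping step). [folklore] -/
theorem sign_transport {α β : Type*} [DecidableEq α] [Fintype α] [DecidableEq β] [Fintype β]
    (e : α ≃ β) (π : Equiv.Perm α) : Equiv.Perm.sign (e.permCongr π) = Equiv.Perm.sign π :=
  Equiv.Perm.sign_permCongr e π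

end

end Summit.ValiantsHypothesis.ValiantsHypothesis.Theorems.GeneratorObstructions.PowGenDegreeQP
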